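import Literature.NumberTheory.IwasawaTheory.Greenberg2016.RestrictedRamificationBridge
import Literature.NumberTheory.GaloisRepresentations.TateDualLimitLocalPairing
import HarnessLib

/-!
# Greenberg's finite levels `𝐃[𝔪ᵏ] ⊆ 𝐃` as a torsion tower of the inflated `Γ_K`-module, and the
# specification `𝓛` read on `Γ_K` (Greenberg 2010 §2, §3.2)

Topic `NumberTheory/IwasawaTheory/Greenberg2016`; namespace
`Literature.NumberTheory.IwasawaTheory.Greenberg2016`.  Two definitions with bodies
(`lambdaTorsionLayers`, `specSelmerStructure`) and their bridging lemmas (all `rfl` / one rewrite);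
no named fact, no `sorry`, no instance, no notation.  Lane «SUR-Λ» of cell `bsd-eis` (road memo
`SUR-LAMBDA-ROAD-w5g9.md` §2 ★(ε), brick C6c), `--supports stmt-BirchSwinnertonDyer-19032`.

MATHEMATICS (R. Greenberg, Kyoto J. Math. 50 (2010), §2 p. 6 L1–12 and §3.2 p. 15): `𝐃` is a
discrete `Λ`-module with a continuous `Λ`-linear action `ρ` of `Gal(K_Σ/K)`; its finite
`Gal(K_Σ/K)`-submodules `𝐃[𝔪ᵏ]` (`p^k · 𝐃[𝔪ᵏ] = 0`, increasing, exhausting `𝐃`) form the tower from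
which `T* = lim_k Hom(𝐃[𝔪ᵏ], μ_{p^k})` is built, and the local conditions `L(K_v, 𝐃)`, `v ∈ Σ`, of a
specification `𝓛` are subgroups of `H¹(K_v, 𝐃)`.  The tree keeps the Poitou–Tate side on DISCRETE
`Γ_K`-MODULES (`DiscreteGaloisModule`; the tower datum `TorsionLayers` of
`PontryaginTateDualInverseLimit.lean`, Selmer structures `SelmerStructure`), and Greenberg's arena on
`ContinuousRep (GaloisGroupUnramifiedOutside K S) Λ 𝐃` (`SelmerGroupStructure.lean`); the bridge is
`RestrictedRamificationBridge.lean` (`toGaloisModule S ρ`, `localHAddEquiv`).  This file transports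
the two remaining data across that bridge:

* §1 `lambdaTorsionLayers S ρ p N … : (toGaloisModule S ρ).TorsionLayers p` — a `ρ`-stable, monotone,
  exhaustive tower `N : ℕ → Submodule Λ 𝐃` of finite `p^k`-torsion `Λ`-submodules (Greenberg's
  `𝐃[𝔪ᵏ]`), with scalars restricted to `ℤ`.  ITS `k`-TH LAYER MODULE IS DEFINITIONALLY the inflated
  module of Greenberg's sub-representation `ρ|_{N k}` (`layerRep_lambdaTorsionLayers`, `rfl`), and the
  push-forwards `(N k ⊆ 𝐃)_*`, `(N n ⊆ N m)_*` on `H¹(K_v, ·)` of `TateDualLimitLocalPairing.lean` are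
  definitionally `H¹` of the corresponding `toGaloisModuleLocalHom`s (`localSubtypeMap_lambdaTorsionLayers`,
  `localInclMap_lambdaTorsionLayers`), hence correspond under `localHAddEquiv` to Greenberg's `Hmap`
  (`localHAddEquiv_localSubtypeMap`, `localHAddEquiv_localInclMap`).
* §2 `specSelmerStructure S ρ L : SelmerStructure (toGaloisModule S ρ)` — the specification `𝓛`
  read on `H¹(Γ_{K_v}, 𝐃)` through `localHAddEquiv` (at every place; only the values on `Σ` matter),
  with `localSubtypeMap_mem_specSelmerStructure_iff`: a level-`k` local class satisfies it iff its
  image under Greenberg's `Hmap (N k ⊆ 𝐃)` lies in `L(K_v, 𝐃)` — the hypothesis `h𝓕T` of the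
  finite-level Poitou–Tate lift (Summits-side `SurLambda.exists_phi_eq_of_level`).

HONESTY: bookkeeping only; nothing of Greenberg's propositions or of BSD is proved here.  AI
formalisation, weaker than expert review; the statements are established only by the kernel check.

## References
* R. Greenberg, *Surjectivity of the global-to-local map defining a Selmer group*, Kyoto J. Math.
  50 (2010) 853–888, §2 p. 6 L1–12, §3.2 p. 15. [Greenberg2010]
* R. Greenberg, *On the structure of Selmer groups*, Springer PROMS 188 (2016), §1 p. 3.
  [Greenberg2016Selmer]
* D. Harari, *Galois Cohomology and Class Field Theory* (2020), §17.2 (p. 290). [Harari2020]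
-/

noncomputable section

open Function NumberField Field IsDedekindDomain CategoryTheory
open scoped NumberField ContRepresentation

namespace Literature.NumberTheory.IwasawaTheory.Greenberg2016

open Literature.NumberTheory.GaloisRepresentations
open Literature.NumberTheory.GaloisRepresentations.DiscreteGaloisModule

variable {K : Type} [Field K] [NumberField K] (S : Set (HeightOneSpectrum (𝓞 K)))
variable {Λ : Type} [CommRing Λ] [TopologicalSpace Λ]
variable {D : Type} [AddCommGroup D] [Module Λ D] [TopologicalSpace D] [DiscreteTopology D]
variable (ρ : ContinuousRep (GaloisGroupUnramifiedOutside K S) Λ D) (p : ℕ)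

/-! ### §1. The tower of finite `Λ`-levels as `TorsionLayers` of the inflated module -/

/-- **Greenberg's finite levels as a torsion tower of the `Γ_K`-module `𝐃`**: a monotone, `ρ`-stable,
exhaustive family `N k` of finite `Λ`-submodules with `p^k · N k = 0` (e.g. `N k = 𝐃[𝔪ᵏ]`), scalars
restricted to `ℤ`, as `TorsionLayers` of `toGaloisModule S ρ`. [cite: Greenberg2010, §2 p. 6 L1–12] -/
def lambdaTorsionLayers (N : ℕ → Submodule Λ D) (hmono : Monotone N)
    (hN : ∀ (k : ℕ) (g : GaloisGroupUnramifiedOutside K S), N k ≤ (N k).comap (ρ g))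
    (htors : ∀ (k : ℕ), ∀ d ∈ N k, (p ^ k) • d = 0) (hfin : ∀ k, Finite (N k))
    (hex : ∀ d : D, ∃ k, d ∈ N k) : (toGaloisModule S ρ).TorsionLayers p where
  N k := (N k).restrictScalars ℤ
  mono _ _ h := fun _ hd => hmono h hd
  stable k σ := fun _ hd => hN k (toUnramifiedQuot K S σ) hd
  torsion k d hd := htors k d hd
  finite k := hfin k
  exhaustive d := hex d

variable (N : ℕ → Submodule Λ D) (hmono : Monotone N)
  (hN : ∀ (k : ℕ) (g : GaloisGroupUnramifiedOutside K S), N k ≤ (N k).comap (ρ g))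
  (htors : ∀ (k : ℕ), ∀ d ∈ N k, (p ^ k) • d = 0) (hfin : ∀ k, Finite (N k))
  (hex : ∀ d : D, ∃ k, d ∈ N k)

omit [NumberField K] in
/-- The layers are the `N k` (scalars restricted to `ℤ`). [cite: Greenberg2010, §2 p. 6 L1–12] -/
@[simp] theorem lambdaTorsionLayers_N (k : ℕ) :
    (lambdaTorsionLayers S ρ p N hmono hN htors hfin hex).N k = (N k).restrictScalars ℤ := rfl

omit [NumberField K] in
/-- **The `k`-th layer module is the inflated module of `ρ|_{N k}`, definitionally.**
[cite: Greenberg2010, §2 p. 6 L1–12] -/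
theorem layerRep_lambdaTorsionLayers (k : ℕ) :
    (lambdaTorsionLayers S ρ p N hmono hN htors hfin hex).layerRep k =
      toGaloisModule S (ρ.subrepresentation (N k) (hN k)) := rfl

omit [NumberField K] in
/-- Off `S` every layer is unramified (it is inflated from `G_{K,S}`). [cite: Harari2020, §17.2 (p. 290)] -/
theorem isUnramifiedAt_layerRep_lambdaTorsionLayers (k : ℕ) {v : HeightOneSpectrum (𝓞 K)} (hv : v ∉ S) :
    GaloisRep.IsUnramifiedAt v ((lambdaTorsionLayers S ρ p N hmono hN htors hfin hex).layerRep k) :=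
  isUnramifiedOutside_toGaloisModule S (ρ.subrepresentation (N k) (hN k)) v hv

omit [NumberField K] [TopologicalSpace Λ] [TopologicalSpace D] in
include htors in
/-- `p^k` kills the level `N k` (as elements of the subtype). [cite: Greenberg2010, §2 p. 6 L1–12] -/
theorem pow_smul_eq_zero_of_level (k : ℕ) (c : N k) : (p ^ k) • c = 0 :=
  Subtype.ext (by simpa using htors k c c.2)

/-- `(N k ⊆ 𝐃)_*` on `H¹(K_v, ·)` is `H¹` of the `toGaloisModuleLocalHom` of the inclusion, definitionally.
[cite: Greenberg2010, §3.1 p. 14] -/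
theorem localSubtypeMap_lambdaTorsionLayers (v : Place K) (k : ℕ)
    (z : galoisCohomology (((lambdaTorsionLayers S ρ p N hmono hN htors hfin hex).layerRep k).toLocal v) 1) :
    (lambdaTorsionLayers S ρ p N hmono hN htors hfin hex).localSubtypeMap v k z =
      galoisCohomology.map (toGaloisModuleLocalHom S (ρ.subrepresentation (N k) (hN k)) ρ
        (N k).subtypeL (fun _ _ ↦ rfl) v) 1 z := rfl

/-- `(N n ⊆ N m)_*` on `H¹(K_v, ·)` is `H¹` of the `toGaloisModuleLocalHom` of the inclusion, definitionally.
[cite: Greenberg2010, §3.1 p. 14] -/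
theorem localInclMap_lambdaTorsionLayers (v : Place K) {n m : ℕ} (h : n ≤ m)
    (z : galoisCohomology (((lambdaTorsionLayers S ρ p N hmono hN htors hfin hex).layerRep n).toLocal v) 1) :
    (lambdaTorsionLayers S ρ p N hmono hN htors hfin hex).localInclMap v h z =
      galoisCohomology.map (toGaloisModuleLocalHom S (ρ.subrepresentation (N n) (hN n))
        (ρ.subrepresentation (N m) (hN m))
        ⟨Submodule.inclusion (hmono h), continuous_of_discreteTopology⟩ (fun _ _ ↦ rfl) v) 1 z := rfl

variable [ContinuousSMul Λ D]

/-- **`localHAddEquiv ∘ (N k ⊆ 𝐃)_* = Hmap (N k ⊆ 𝐃) ∘ localHAddEquiv`** on `H¹(K_v, N k)`.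
[cite: Greenberg2010, §3.1 p. 14] [cite: Harari2020, §17.2 (p. 290)] -/
theorem localHAddEquiv_localSubtypeMap (v : Place K) (k : ℕ)
    (z : galoisCohomology (((lambdaTorsionLayers S ρ p N hmono hN htors hfin hex).layerRep k).toLocal v) 1) :
    localHAddEquiv S ρ v 1 ((lambdaTorsionLayers S ρ p N hmono hN htors hfin hex).localSubtypeMap v k z) =
      Hmap (localRep S (ρ.subrepresentation (N k) (hN k)) v) (localRep S ρ v) (N k).subtypeL
        (fun _ _ ↦ rfl) 1 (localHAddEquiv S (ρ.subrepresentation (N k) (hN k)) v 1 z) :=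
  (Hmap_localHAddEquiv S (ρ.subrepresentation (N k) (hN k)) ρ (N k).subtypeL (fun _ _ ↦ rfl) v 1 z).symm

/-- **`localHAddEquiv ∘ (N n ⊆ N m)_* = Hmap (N n ⊆ N m) ∘ localHAddEquiv`** on `H¹(K_v, N n)`.
[cite: Greenberg2010, §3.1 p. 14] [cite: Harari2020, §17.2 (p. 290)] -/
theorem localHAddEquiv_localInclMap (v : Place K) {n m : ℕ} (h : n ≤ m)
    (z : galoisCohomology (((lambdaTorsionLayers S ρ p N hmono hN htors hfin hex).layerRep n).toLocal v) 1) :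
    localHAddEquiv S (ρ.subrepresentation (N m) (hN m)) v 1
        ((lambdaTorsionLayers S ρ p N hmono hN htors hfin hex).localInclMap v h z) =
      Hmap (localRep S (ρ.subrepresentation (N n) (hN n)) v)
        (localRep S (ρ.subrepresentation (N m) (hN m)) v)
        ⟨Submodule.inclusion (hmono h), continuous_of_discreteTopology⟩ (fun _ _ ↦ rfl) 1
        (localHAddEquiv S (ρ.subrepresentation (N n) (hN n)) v 1 z) :=
  (Hmap_localHAddEquiv S (ρ.subrepresentation (N n) (hN n)) (ρ.subrepresentation (N m) (hN m))
    ⟨Submodule.inclusion (hmono h), continuous_of_discreteTopology⟩ (fun _ _ ↦ rfl) v 1 z).symm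

/-! ### §2. The specification read on the `Γ_K`-side -/

/-- **The specification `𝓛` as a Selmer structure of the inflated `Γ_K`-module `𝐃`**: at the place
`v`, the preimage of `L(K_v, 𝐃) ≤ (localRep S ρ v).H 1` under the local comparison
`localHAddEquiv S ρ v 1 : H¹(Γ_{K_v}, 𝐃) ≃+ H¹(K_v, 𝐃)`. [cite: Greenberg2016Selmer, §1 p. 3 L19–21]
[cite: Greenberg2010, §3.2 p. 15] -/
def specSelmerStructure (L : Specification S ρ) : SelmerStructure (toGaloisModule S ρ) :=
  fun v => (L v).toAddSubgroup.comap (localHAddEquiv S ρ v 1).toAddMonoidHom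

/-- Membership: `z ∈ 𝓛^{Γ}_v ↔ localHAddEquiv z ∈ L(K_v, 𝐃)`. [cite: Greenberg2016Selmer, §1 p. 3 L19–21] -/
@[simp] theorem mem_specSelmerStructure_iff (L : Specification S ρ) (v : Place K)
    (z : galoisCohomology ((toGaloisModule S ρ).toLocal v) 1) :
    z ∈ specSelmerStructure S ρ L v ↔ localHAddEquiv S ρ v 1 z ∈ L v := Iff.rfl

/-- **A level-`k` local class satisfies `𝓛` iff Greenberg's `Hmap (N k ⊆ 𝐃)` of its image in
`H¹(K_v, N k)` lies in `L(K_v, 𝐃)`** — the hypothesis `h𝓕T` of the finite-level Poitou–Tate lift.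
[cite: Greenberg2010, §3.2, proof of Prop. 3.2.1 (p. 15)] -/
theorem localSubtypeMap_mem_specSelmerStructure_iff (L : Specification S ρ) (v : Place K) (k : ℕ)
    (z : galoisCohomology (((lambdaTorsionLayers S ρ p N hmono hN htors hfin hex).layerRep k).toLocal v) 1) :
    (lambdaTorsionLayers S ρ p N hmono hN htors hfin hex).localSubtypeMap v k z ∈
        specSelmerStructure S ρ L v ↔
      Hmap (localRep S (ρ.subrepresentation (N k) (hN k)) v) (localRep S ρ v) (N k).subtypeL
        (fun _ _ ↦ rfl) 1 (localHAddEquiv S (ρ.subrepresentation (N k) (hN k)) v 1 z) ∈ L v := by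
  rw [mem_specSelmerStructure_iff, localHAddEquiv_localSubtypeMap]

end Literature.NumberTheory.IwasawaTheory.Greenberg2016
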